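import Literature.NumberTheory.Transcendental.RoySmallValueAlgebraicPoints
import Literature.NumberTheory.Transcendental.RoySmallValueFiniteZeros
import Literature.NumberTheory.Transcendental.RoySmallValueDistance
import Mathlib.Analysis.Normed.Module.RCLike.Basic
import HarnessLib

/-!
# Roy's small value estimate for `𝔾ₐ × 𝔾ₘ` — algebraic zeros keep a positive distance from `(1 : γ)`

Topic `Literature/NumberTheory/Transcendental`. Part of the formalisation of the proof of Roy 2013,
Theorem 1.1 (named fact `roy2013_thm_1_1`, `RoySmallValueEstimates.lean`), seat B. Source: D. Roy,
*A small value estimate for `𝔾ₐ × 𝔾ₘ`*, Mathematika 59 (2013) 333–363 = arXiv:1301.0663, §7,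
end of Step 2 and Step 3 (pp. 18–19 of the arXiv text):

> [...] the point `α₀` runs through an infinite sequence of points of `ℙ²(ℚ̄)` converging to
> `(1:γ)` but distinct from `(1:γ)` (because `(1:γ) ∉ ℙ²(ℚ̄)`).
> [...] `D*` goes to infinity with `D` because [...] `𝒵(𝒟ⁱP̃_{D*+1} ; 0 ≤ i ≤ D*+1)(ℂ)` is a
> finite subset of `ℙ²(ℚ̄)` and so, for fixed `D* ≥ 1`, this set does not contain the point `α₀`
> of `Z(ℂ)` when `D` is large enough.

The quantitative content used by the assembly: if `(ξ, η)` are NOT both algebraic and `P, Q` are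
coprime rational forms of the same degree, then the (finitely many, algebraic) common zeros of
`P, Q` stay at projective distance `≥ ε > 0` from `(1 : ξ : η)` (`exists_pdist_lower_bound`), with
Roy's distance `pdist` of `RoySmallValueDistance` ((4.1), for sup-normalised representatives).
Ingredients: `finite_common_zeros` (finitely many zeros up to scaling), the parallel seat's
`isAlgebraic_ratio_of_common_zero` (their ratios are algebraic), `pdist_smul` (homogeneity of the
distance) and `eq_smul_of_pdist_eq_zero` (`dist(α, (1:γ)) = 0` only for `α ∈ ℂ·(1, ξ, η)`).
Everything is proved; no definitions, no named facts.

## References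

* [Roy2013] D. Roy, *A small value estimate for 𝔾ₐ × 𝔾ₘ*, Mathematika 59 (2013), 333–363
  (arXiv:1301.0663), §7, Step 2 (last paragraph) and Step 3.
-/

noncomputable section

open MvPolynomial Finset

namespace Literature.NumberTheory.Transcendental

namespace Roy2013

/-! ### Homogeneity and vanishing of the projective distance -/

/-- `dist(tα, (1:γ)) = |t| dist(α, (1:γ))`. [cite: Roy2013, §4, (4.1)] -/
theorem pdist_smul (ξ η t : ℂ) (α : Fin 3 → ℂ) : pdist ξ η (t • α) = ‖t‖ * pdist ξ η α := by
  simp only [pdist, Pi.smul_apply, smul_eq_mul]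
  have h1 : t * α 1 - t * α 0 * ξ = t * (α 1 - α 0 * ξ) := by ring
  have h2 : t * α 2 - t * α 0 * η = t * (α 2 - α 0 * η) := by ring
  have h3 : t * α 1 * η - t * α 2 * ξ = t * (α 1 * η - α 2 * ξ) := by ring
  rw [h1, h2, h3, norm_mul, norm_mul, norm_mul, ← mul_max_of_nonneg _ _ (norm_nonneg t),
    ← mul_max_of_nonneg _ _ (norm_nonneg t), mul_div_assoc]

/-- **`dist(α, (1:γ)) = 0` forces `α = α₀ · (1, ξ, η)`.** [cite: Roy2013, §4, (4.1)] -/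
theorem eq_smul_of_pdist_eq_zero {ξ η : ℂ} {α : Fin 3 → ℂ} (h : pdist ξ η α = 0) :
    α = α 0 • ![1, ξ, η] := by
  have hc : 0 < roy_c2 ξ η := lt_of_lt_of_le one_pos (one_le_roy_c2 ξ η)
  rw [pdist, div_eq_zero_iff, or_iff_left hc.ne'] at h
  have hmax : max ‖α 1 - α 0 * ξ‖ ‖α 2 - α 0 * η‖ ≤ 0 := by
    have := le_max_left (max ‖α 1 - α 0 * ξ‖ ‖α 2 - α 0 * η‖) ‖α 1 * η - α 2 * ξ‖
    rw [h] at this; exact this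
  have h1 : α 1 = α 0 * ξ :=
    sub_eq_zero.mp (norm_le_zero_iff.mp ((le_max_left _ _).trans hmax))
  have h2 : α 2 = α 0 * η :=
    sub_eq_zero.mp (norm_le_zero_iff.mp ((le_max_right _ _).trans hmax))
  funext i
  fin_cases i
  · simp
  · simp [h1]
  · simp [h2]

/-- A point of `ℂ·(1, ξ, η)` with algebraic ratios has `ξ, η` algebraic. [folklore] -/
theorem isAlgebraic_of_eq_smul {ξ η : ℂ} {α : Fin 3 → ℂ} (hα : α ≠ 0) (h : α = α 0 • ![1, ξ, η])
    (halg : ∀ i, IsAlgebraic ℚ (α i / α 0)) : IsAlgebraic ℚ ξ ∧ IsAlgebraic ℚ η := by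
  have h0 : α 0 ≠ 0 := by
    intro h0; apply hα; rw [h, h0, zero_smul]
  have h1 : α 1 / α 0 = ξ := by
    conv_lhs => rw [h]
    simp [h0]
  have h2 : α 2 / α 0 = η := by
    conv_lhs => rw [h]
    simp [h0]
  exact ⟨h1 ▸ halg 1, h2 ▸ halg 2⟩

/-! ### The separation -/

/-- **The common zeros of two coprime rational forms keep a positive distance from `(1:γ)` when
`(ξ, η)` are not both algebraic.** [cite: Roy2013, §7, Step 3 ("for fixed `D*`, this set does not
contain the point `α₀` … when `D` is large enough") and Step 2 ("distinct from `(1:γ)`")] -/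
theorem exists_pdist_lower_bound {ξ η : ℂ} (hna : ¬(IsAlgebraic ℚ ξ ∧ IsAlgebraic ℚ η))
    {P Q : QX} {D : ℕ} (hP : P.IsHomogeneous D) (hQ : Q.IsHomogeneous D) (hP0 : toCX P ≠ 0)
    (hQ0 : toCX Q ≠ 0) (hPQ : IsRelPrime (toCX P) (toCX Q)) :
    ∃ ε : ℝ, 0 < ε ∧ ∀ α : Fin 3 → ℂ, ‖α‖ = 1 → eval α (toCX P) = 0 → eval α (toCX Q) = 0 →
      ε ≤ pdist ξ η α := by
  classical
  have hPh := isHomogeneous_toCX hP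
  have hQh := isHomogeneous_toCX hQ
  have e : ∀ (β : Fin 3 → ℂ) (f : CX), aeval β f = eval β f :=
    fun β f => DFunLike.congr_fun (coe_aeval_eq_eval β) f
  have hreg : ∀ f : CX, toCX Q * f ∈ Ideal.span {toCX P} → f ∈ Ideal.span {toCX P} :=
    fun f hf => Ideal.mem_span_singleton.mpr
      (hPQ.dvd_of_dvd_mul_left (Ideal.mem_span_singleton.mp hf))
  obtain ⟨S, hS0, hcov⟩ := finite_common_zeros hPh hQh hPQ
  -- keep the representatives which are common zeros, and normalise them
  set S' := S.filter (fun s => eval s (toCX P) = 0 ∧ eval s (toCX Q) = 0) with hS'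
  set u : (Fin 3 → ℂ) → (Fin 3 → ℂ) := fun s => ((‖s‖⁻¹ : ℝ) : ℂ) • s with hu
  -- every normalised zero representative is at positive distance
  have hpos : ∀ s ∈ S', 0 < pdist ξ η (u s) := by
    intro s hs
    obtain ⟨hsS, hsP, hsQ⟩ := mem_filter.mp hs
    have hs0 : s ≠ 0 := hS0 s hsS
    have hns : ‖s‖ ≠ 0 := norm_ne_zero_iff.mpr hs0
    have hu0 : u s ≠ 0 := by
      simp only [hu]
      exact smul_ne_zero (by exact_mod_cast inv_ne_zero hns) hs0
    refine lt_of_le_of_ne (pdist_nonneg ξ η _) fun h0 => ?_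
    have hprop := eq_smul_of_pdist_eq_zero h0.symm
    -- the ratios of `u s` are those of `s`, hence algebraic
    have huP : eval (u s) (toCX P) = 0 := by
      rw [← e, hu, aeval_smul_of_isHomogeneous hPh, e, hsP, mul_zero]
    have huQ : eval (u s) (toCX Q) = 0 := by
      rw [← e, hu, aeval_smul_of_isHomogeneous hQh, e, hsQ, mul_zero]
    have hu00 : u s 0 ≠ 0 := by
      intro hz; apply hu0; rw [hprop, hz, zero_smul]
    exact hna (isAlgebraic_of_eq_smul hu0 hprop fun i =>
      isAlgebraic_ratio_of_common_zero hP hQ hP0 hQ0 hreg huP huQ hu00 i)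
  -- the bound
  by_cases hne : S'.Nonempty
  · obtain ⟨s₀, hs₀, hmin⟩ := Finset.exists_min_image S' (fun s => pdist ξ η (u s)) hne
    refine ⟨pdist ξ η (u s₀), hpos s₀ hs₀, fun α hα1 hαP hαQ => ?_⟩
    have hα0 : α ≠ 0 := by
      intro h; rw [h, norm_zero] at hα1; exact zero_ne_one hα1
    obtain ⟨s, hsS, c, hαcs⟩ := hcov α hα0 ((e α _).trans hαP) ((e α _).trans hαQ)
    have hs0 : s ≠ 0 := hS0 s hsS
    have hc0 : c ≠ 0 := by
      intro h; apply hα0; rw [hαcs, h, zero_smul]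
    have hsS' : s ∈ S' := by
      refine mem_filter.mpr ⟨hsS, ?_, ?_⟩
      · have h1 : eval α (toCX P) = c ^ D * eval s (toCX P) := by
          rw [← e, hαcs, aeval_smul_of_isHomogeneous hPh, e]
        rw [hαP] at h1
        exact (mul_eq_zero.mp h1.symm).resolve_left (pow_ne_zero _ hc0)
      · have h1 : eval α (toCX Q) = c ^ D * eval s (toCX Q) := by
          rw [← e, hαcs, aeval_smul_of_isHomogeneous hQh, e]
        rw [hαQ] at h1
        exact (mul_eq_zero.mp h1.symm).resolve_left (pow_ne_zero _ hc0)
    -- `α = (c ‖s‖) • u s` with `|c| ‖s‖ = 1`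
    have hns : ‖s‖ ≠ 0 := norm_ne_zero_iff.mpr hs0
    have hαu : α = (c * (‖s‖ : ℂ)) • u s := by
      rw [hαcs, hu, smul_smul, mul_assoc, ← Complex.ofReal_mul, mul_inv_cancel₀ hns,
        Complex.ofReal_one, mul_one]
    have hnorm : ‖c * (‖s‖ : ℂ)‖ = 1 := by
      have := congrArg norm hαcs
      rw [hα1, norm_smul] at this
      rw [norm_mul, Complex.norm_real, Real.norm_eq_abs, abs_norm]
      exact this.symm
    calc pdist ξ η (u s₀) ≤ pdist ξ η (u s) := hmin s hsS'
      _ = pdist ξ η α := by rw [hαu, pdist_smul ξ η (c * (‖s‖ : ℂ)) (u s), hnorm, one_mul]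
  · refine ⟨1, one_pos, fun α hα1 hαP hαQ => ?_⟩
    exfalso
    have hα0 : α ≠ 0 := by
      intro h; rw [h, norm_zero] at hα1; exact zero_ne_one hα1
    obtain ⟨s, hsS, c, hαcs⟩ := hcov α hα0 ((e α _).trans hαP) ((e α _).trans hαQ)
    have hc0 : c ≠ 0 := by
      intro h; apply hα0; rw [hαcs, h, zero_smul]
    refine hne ⟨s, mem_filter.mpr ⟨hsS, ?_, ?_⟩⟩
    · have h1 : eval α (toCX P) = c ^ D * eval s (toCX P) := by
        rw [← e, hαcs, aeval_smul_of_isHomogeneous hPh, e]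
      rw [hαP] at h1
      exact (mul_eq_zero.mp h1.symm).resolve_left (pow_ne_zero _ hc0)
    · have h1 : eval α (toCX Q) = c ^ D * eval s (toCX Q) := by
        rw [← e, hαcs, aeval_smul_of_isHomogeneous hQh, e]
      rw [hαQ] at h1
      exact (mul_eq_zero.mp h1.symm).resolve_left (pow_ne_zero _ hc0)

end Roy2013

end Literature.NumberTheory.Transcendental
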